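import Mathlib.Data.Finset.Card
import Mathlib.Data.Finset.Erase
import Mathlib.Algebra.BigOperators.Group.Finset.Sigma
import Mathlib.Algebra.BigOperators.Group.Finset.Piecewise
import Mathlib.Algebra.Order.BigOperators.Group.Finset
import Mathlib.Algebra.Group.Action.Defs
import HarnessLib

/-!
# Face counts of the hub–hub graph — the composition steps of the W5 star-family words

Cell `pub-hsemireg`, widening group W5, seat w5-n7-1 (gen 10); files of record
`widen/W5/N7-FEASIBILITY-w5n7.md` (N7F) and `widen/W5/TABLE-W5-N7.md`. HONEST FRAMING: pure finite combinatorics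
of a family `A` of 2-element subsets («hub–hub tori») of a set of coordinates and of the numbers
`#{e ∈ A | e ⊆ S}` of members inside sub-faces `S`. The MACHINE facts of record of the (20,−8) ℚ(i) star family
— every four-coordinate star face carries ≤ 1 hub–hub torus (N7F §3.10 (p)); no five-coordinate star face
carries 0 of them (the ∅⁵ closure, §3.21) nor exactly 1 (leg (K2-2), §3.23); for a fifth margin μ the face
verdicts «star³-∅ UNSAT» / «star³-K₂ UNSAT» (§3.24) — are NOT formalised here: they enter the corollaries below
as hypotheses on face counts. What is kernel-checked is exactly the hand step that composes them («double
count», «restriction»): TABLE-W5-N7 rows N7-22 (o), N7-36 (a), N7-38 (b), N7-38 (c). Nothing here is a statement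
about any variety, sheaf or class, and nothing here bears on HC / HC_CM / HC_AV.

* `filter_subset_erase` — the members inside the co-face `S.erase z` are the members inside `S` missing `z`.
* `sum_card_filter_subset_erase` — the FACE SUM IDENTITY
  `∑_{z ∈ S} #{e ∈ A | e ⊆ S.erase z} = (#S − 2) · #{e ∈ A | e ⊆ S}`.
* `card_le_one_of_faces_four` — «≤ 1 on every 4-face ⇒ ≤ 1 on every face with ≥ 4 coordinates».
* `card_le_five_of_faces` — N7-36 (a): ≤ 1 on 4-faces and no edgeless 5-face ⇒ at most 5 coordinates.
* `card_le_four_of_faces` — N7-38 (b): additionally no 5-face with exactly one member ⇒ at most 4 coordinates.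
* `card_le_four_of_faces_eq_one` — N7-22 (o): exactly one member on every 4-face ⇒ at most 4 coordinates
  (`5 = 3 · #` on a 5-face).
* `false_of_three_faces_pos` / `filter_subset_eq_empty_of_three_faces_ne_one` — N7-38 (c), the mixed-face
  double count: on a 4-face with ≤ 1 member the four 3-faces cannot all carry a member, and if none carries
  exactly one member the 4-face carries none.
-/

open Finset

namespace Summit.Ventures.HSemireg.StarFamilyFaceEdgeCount

variable {V : Type*} [DecidableEq V]

/-- The members of `A` inside the co-face `S.erase z` are the members inside `S` that miss `z`. -/
theorem filter_subset_erase (A : Finset (Finset V)) (S : Finset V) (z : V) :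
    {e ∈ A | e ⊆ S.erase z} = {e ∈ A | e ⊆ S ∧ z ∉ e} := by
  ext e
  simp only [mem_filter, subset_erase]

/-- **FACE SUM IDENTITY.** If every member of `A` has exactly two elements, then summing over the co-faces
`S.erase z`, `z ∈ S`, the numbers of members inside them gives `(#S − 2) · #{e ∈ A | e ⊆ S}`: a 2-set inside
`S` lies in the co-face `S.erase z` exactly when `z` is one of the `#S − 2` elements of `S` off the 2-set. -/
theorem sum_card_filter_subset_erase (A : Finset (Finset V)) (hA : ∀ e ∈ A, e.card = 2) (S : Finset V) :
    ∑ z ∈ S, #{e ∈ A | e ⊆ S.erase z} = (S.card - 2) * #{e ∈ A | e ⊆ S} := by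
  calc ∑ z ∈ S, #{e ∈ A | e ⊆ S.erase z}
      = ∑ z ∈ S, ∑ e ∈ A with e ⊆ S, (if z ∉ e then 1 else 0) := by
        refine sum_congr rfl fun z _ => ?_
        rw [filter_subset_erase, ← filter_filter, card_filter]
    _ = ∑ e ∈ A with e ⊆ S, ∑ z ∈ S, (if z ∉ e then 1 else 0) := sum_comm
    _ = ∑ e ∈ A with e ⊆ S, (S.card - 2) := by
        refine sum_congr rfl fun e he => ?_
        rw [mem_filter] at he
        rw [← card_filter, ← sdiff_eq_filter, card_sdiff_of_subset he.2, hA e he.1]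
    _ = (S.card - 2) * #{e ∈ A | e ⊆ S} := by
        rw [sum_const, smul_eq_mul, mul_comm]

/-- Two members with two elements each span at most four coordinates, so «at most one member inside every
4-face of `T`» propagates to every face of `T` with at least four coordinates. -/
theorem card_le_one_of_faces_four {A : Finset (Finset V)} (hA : ∀ e ∈ A, e.card = 2)
    {T : Finset V} (h4 : ∀ S ⊆ T, S.card = 4 → #{e ∈ A | e ⊆ S} ≤ 1)
    {S : Finset V} (hST : S ⊆ T) (hS : 4 ≤ S.card) :
    #{e ∈ A | e ⊆ S} ≤ 1 := by
  by_contra hlt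
  rw [not_le, one_lt_card] at hlt
  obtain ⟨e, he, f, hf, hef⟩ := hlt
  rw [mem_filter] at he hf
  have hU : (e ∪ f) ⊆ S := union_subset he.2 hf.2
  have hUcard : (e ∪ f).card ≤ 4 := by
    calc (e ∪ f).card ≤ e.card + f.card := card_union_le _ _
      _ = 4 := by rw [hA e he.1, hA f hf.1]
  obtain ⟨U, heU, hUS, hU4⟩ := exists_subsuperset_card_eq hU hUcard hS
  have h1 : #{e ∈ A | e ⊆ U} ≤ 1 := h4 U (hUS.trans hST) hU4
  have h2 : 1 < #{e ∈ A | e ⊆ U} := by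
    rw [one_lt_card]
    exact ⟨e, mem_filter.2 ⟨he.1, subset_union_left.trans heU⟩,
      f, mem_filter.2 ⟨hf.1, subset_union_right.trans heU⟩, hef⟩
  omega

/-- **N7-36 (a), abstract form («no design on ≥ 6 star coordinates»).** If every 4-face of `T` carries at most
one member of `A` and no 5-face of `T` carries zero members, then `T` has at most five coordinates: a 6-face
would carry ≤ 1 member, and deleting one of its endpoints (or any point, if there is none) leaves a 5-face
carrying no member. -/
theorem card_le_five_of_faces {A : Finset (Finset V)} (hA : ∀ e ∈ A, e.card = 2) {T : Finset V}
    (h4 : ∀ S ⊆ T, S.card = 4 → #{e ∈ A | e ⊆ S} ≤ 1)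
    (h5 : ∀ S ⊆ T, S.card = 5 → 1 ≤ #{e ∈ A | e ⊆ S}) :
    T.card ≤ 5 := by
  by_contra hT
  rw [not_le] at hT
  obtain ⟨S, hST, hS6⟩ := exists_subset_card_eq (show 6 ≤ T.card by omega)
  have hle : #{e ∈ A | e ⊆ S} ≤ 1 := card_le_one_of_faces_four hA h4 hST (by omega)
  -- a point `a ∈ S` lying on every member inside `S` (there is at most one member)
  obtain ⟨a, haS, ha⟩ : ∃ a ∈ S, ∀ e ∈ A, e ⊆ S → a ∈ e := by
    rcases Nat.le_one_iff_eq_zero_or_eq_one.1 hle with h0 | h1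
    · obtain ⟨a, ha⟩ : S.Nonempty := by rw [← card_pos]; omega
      refine ⟨a, ha, fun e he heS => ?_⟩
      have : e ∈ ({e ∈ A | e ⊆ S} : Finset (Finset V)) := mem_filter.2 ⟨he, heS⟩
      rw [card_eq_zero.1 h0] at this
      exact absurd this (notMem_empty e)
    · obtain ⟨e, he⟩ := card_eq_one.1 h1
      have heS : e ∈ ({e ∈ A | e ⊆ S} : Finset (Finset V)) := by rw [he]; exact mem_singleton_self e
      rw [mem_filter] at heS
      obtain ⟨a, ha⟩ : e.Nonempty := by rw [← card_pos, hA e heS.1]; omega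
      refine ⟨a, heS.2 ha, fun f hf hfS => ?_⟩
      have : f ∈ ({e ∈ A | e ⊆ S} : Finset (Finset V)) := mem_filter.2 ⟨hf, hfS⟩
      rw [he, mem_singleton] at this
      rw [this]; exact ha
  have hcard : (S.erase a).card = 5 := by rw [card_erase_of_mem haS, hS6]
  have hpos := h5 (S.erase a) ((erase_subset a S).trans hST) hcard
  have hzero : ({e ∈ A | e ⊆ S.erase a} : Finset (Finset V)) = ∅ := by
    rw [filter_subset_erase, filter_eq_empty_iff]
    intro e he h
    exact h.2 (ha e he h.1)
  rw [hzero, card_empty] at hpos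
  omega

/-- **N7-38 (b), abstract form («an n ≥ 5 design has ≤ 4 star coordinates»).** If every 4-face of `T` carries
at most one member of `A`, no 5-face carries zero members, and no 5-face carries exactly one member, then `T`
has at most four coordinates. -/
theorem card_le_four_of_faces {A : Finset (Finset V)} (hA : ∀ e ∈ A, e.card = 2) {T : Finset V}
    (h4 : ∀ S ⊆ T, S.card = 4 → #{e ∈ A | e ⊆ S} ≤ 1)
    (h5 : ∀ S ⊆ T, S.card = 5 → 1 ≤ #{e ∈ A | e ⊆ S})
    (h5' : ∀ S ⊆ T, S.card = 5 → #{e ∈ A | e ⊆ S} ≠ 1) :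
    T.card ≤ 4 := by
  by_contra hT
  rw [not_le] at hT
  obtain ⟨S, hST, hS5⟩ := exists_subset_card_eq (show 5 ≤ T.card by omega)
  have hle : #{e ∈ A | e ⊆ S} ≤ 1 := card_le_one_of_faces_four hA h4 hST (by omega)
  have h1 := h5 S hST hS5
  have h2 := h5' S hST hS5
  omega

/-- **N7-22 (o), abstract form (the (19,−8) ℚ(√−3) double count).** If every 4-face of `T` carries EXACTLY one
member of `A`, then `T` has at most four coordinates: on a 5-face the face sum identity would read
`5 = 3 · #{e ∈ A | e ⊆ S}`. -/
theorem card_le_four_of_faces_eq_one {A : Finset (Finset V)} (hA : ∀ e ∈ A, e.card = 2) {T : Finset V}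
    (h4 : ∀ S ⊆ T, S.card = 4 → #{e ∈ A | e ⊆ S} = 1) :
    T.card ≤ 4 := by
  by_contra hT
  rw [not_le] at hT
  obtain ⟨S, hST, hS5⟩ := exists_subset_card_eq (show 5 ≤ T.card by omega)
  have hsum := sum_card_filter_subset_erase A hA S
  have hfaces : ∑ z ∈ S, #{e ∈ A | e ⊆ S.erase z} = 5 := by
    rw [sum_const_nat (m := 1) fun z hz => h4 (S.erase z) ((erase_subset z S).trans hST)
      (by rw [card_erase_of_mem hz, hS5]), hS5]
  rw [hfaces, hS5] at hsum
  omega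

/-- **N7-38 (c), the mixed-face double count, first half.** On a 4-face `S` carrying at most one member of
`A` the four co-faces `S.erase z` cannot all carry a member: the face sum identity gives
`∑_z #{e ∈ A | e ⊆ S.erase z} = 2 · #{e ∈ A | e ⊆ S} ≤ 2 < 4`. (In the cell's words: «star³-∅ UNSAT for μ»
kills the fifth margin μ next to four stars.) -/
theorem false_of_three_faces_pos {A : Finset (Finset V)} (hA : ∀ e ∈ A, e.card = 2) {S : Finset V}
    (hS : S.card = 4) (hle : #{e ∈ A | e ⊆ S} ≤ 1)
    (h3 : ∀ z ∈ S, 1 ≤ #{e ∈ A | e ⊆ S.erase z}) :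
    False := by
  have hsum := sum_card_filter_subset_erase A hA S
  have hge : S.card * 1 ≤ ∑ z ∈ S, #{e ∈ A | e ⊆ S.erase z} :=
    card_nsmul_le_sum S _ 1 h3 |>.trans_eq' (by rw [smul_eq_mul])
  rw [hsum, hS] at hge
  omega

/-- **N7-38 (c), second half.** On a face `S` with at least three coordinates carrying at most one member of
`A`, if NO co-face `S.erase z` carries exactly one member then `S` carries none: a member `e ⊆ S` would
survive alone in the co-face of any `z ∈ S` off `e`. (In the cell's words: «star³-K₂ UNSAT for μ» forces
`A = ∅` on the four stars.) -/
theorem filter_subset_eq_empty_of_three_faces_ne_one {A : Finset (Finset V)} (hA : ∀ e ∈ A, e.card = 2)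
    {S : Finset V} (hS : 3 ≤ S.card) (hle : #{e ∈ A | e ⊆ S} ≤ 1)
    (h3 : ∀ z ∈ S, #{e ∈ A | e ⊆ S.erase z} ≠ 1) :
    ({e ∈ A | e ⊆ S} : Finset (Finset V)) = ∅ := by
  rcases Nat.le_one_iff_eq_zero_or_eq_one.1 hle with h0 | h1
  · exact card_eq_zero.1 h0
  · exfalso
    obtain ⟨e, he⟩ := card_eq_one.1 h1
    have heS : e ∈ ({e ∈ A | e ⊆ S} : Finset (Finset V)) := by rw [he]; exact mem_singleton_self e
    rw [mem_filter] at heS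
    -- a point of `S` off `e`
    obtain ⟨z, hz⟩ : (S \ e).Nonempty := by
      rw [← card_pos, card_sdiff_of_subset heS.2, hA e heS.1]; omega
    rw [mem_sdiff] at hz
    apply h3 z hz.1
    rw [filter_subset_erase, card_eq_one]
    refine ⟨e, ?_⟩
    ext f
    constructor
    · intro hf
      rw [mem_filter] at hf
      have : f ∈ ({e ∈ A | e ⊆ S} : Finset (Finset V)) := mem_filter.2 ⟨hf.1, hf.2.1⟩
      rwa [he] at this
    · intro hf
      rw [mem_singleton] at hf
      subst hf
      exact mem_filter.2 ⟨heS.1, heS.2, hz.2⟩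

end Summit.Ventures.HSemireg.StarFamilyFaceEdgeCount
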